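import Summits.QuantumFields.BalabanUV.Beta.GAN24.DerivativeRateTransferEnvelope

/-!
# `BalabanUV.Beta.GAN24.DerivativeRateTransferGamma` — binder row G-an2-4 ∕ (CONV-C), route R6 «VALUES, NOT DERIVATIVES», PART 6:
# step S3 (first order) FOR THE FLUCTUATION BLOCK `Γ = G` (the constrained propagator `C^{(k)}(𝟙)`-type block of `M_k(B)⁻¹`) from uniform
# bounds along the background family — via the CONSTRAINED RESOLVENT IDENTITY `G₁ − G₀ = −G₀(K₁ − K₀)G₁`, proved here from an1's
# `Beta.Envelope` algebra (unit b2b-balaban-gan24-p3, gen 24; v1)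

NOT IN PRINT; OUR PROOF ATTEMPT (for the ROUTE; every statement below is [folklore] finite-dimensional algebra + the triangle inequality in
the `ℓ²`-operator norm).  HONEST FRAMING (cell contract, verbatim): «discharging `BetaPertH` makes Bałaban's UV stability UNCONDITIONAL — a
real constructive-QFT result; it is NOT the continuum limit and NOT the Clay problem.»  HONEST DEPENDENCY (verbatim): «continuum YM on T⁴ ⇐
BetaPertH ∧ nine spine estimates (0/9 proved); BetaPertH ⇐ (D1) ∧ (D4) ∧ CAP+tail; G-an2-4 gates asym, D1 and NE2/3/4.»  Route R6, steps S1–S6: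
header of PART 1 (`GAN24.DerivativeRateTransfer`); PART 5 (`…Envelope`) did the value block `Σ` and the minimiser block `Ξ`.

WHAT THIS FILE PROVES (0 sorry; complex matrices, fixed constraint map `Q`; imports PART 5):
§1 `constrProp_mul_self : G K = 1 − H Q` and **`constrProp_sub_constrProp : G₁ − G₀ = −(G₀ (K₁ − K₀) G₁)`** — the constrained-resolvent identity
   (from `Beta.Envelope.mul_constrProp : K G = 1 − Qᵀ Hᴸ`, `constrProp_mul_transpose : G Qᵀ = 0`, `constraint_mul_constrProp : Q G = 0`;
   AN1 Table T row T1's «tadpole −½Tr(Γ∂²) AND bubble ½Tr(Γ∂Γ∂)» are exactly the first two orders of this identity);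
§2 **`constrProp_sym_diff_eq`**: `G(h) − G(−h) + 2h·G₀K′G₀ = −G₀(K(h) − K(−h) − 2h·K′)G₀ + (G₀E₊G₀E₊G₊ − G₀E₋G₀E₋G₋)` and
   **`constrProp_taylor_form`**: `‖G(h) − G(−h) + 2h·G₀K′G₀‖ ≤ B_G²(M_K + 2B_G L_K²)·h²` for `0 < h ≤ γ` under `‖G(s)‖ ≤ B_G` on `|s| ≤ γ`,
   `‖K(s) − K(0)‖ ≤ L_K|s|`, `‖K(h) − K(−h) − 2hK′‖ ≤ M_K h²`; the insertion is `∂_sG(0) = −G₀K′G₀`;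
§3 `constrProp_taylor_form_entry_re` and the family junction **`transferInput₁_constrProp`** (fixed finite index set — MODEL statement) = PART 1's
   [shape] `TransferInput₁` for `F_k(s) = Re G_k(s)_{yy′}`, `dF_k = −Re (G_k(0)K′_kG_k(0))_{yy′}`, Taylor constant `B_G²(M_K + 2B_G L_K²)`.
TOGETHER WITH PART 5: for all three blocks `Γ, Ξ, Σ` of `M_k(B)⁻¹` at FIXED `Q`, R6-S3 (first order) costs exactly UNIFORM BOUNDS ALONG THE FAMILY
(`‖G_k(s)‖`, `‖H_k(s)‖`, `‖H_k(0)ᴸ‖` — the printed KIND of bound, S2-type debt) plus the Lipschitz ∕ first-order Taylor form of the FINE form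
`s ↦ K_k(s)` (local vertex data) — NO analyticity, NO Cauchy estimate.  NOT covered: the variation of `Q(B)` (Table T rows T7∕T8), second
order, any instantiation on Bałaban's objects.  SUPPLIER work on the route of record; NOT one of the nine spine estimates; NEVER «G-an2-4
closed»; NOT (CONV-C), NOT D1, NOT `BetaPertH`, NOT continuum, NOT Clay.
-/

noncomputable section

open scoped Matrix Matrix.Norms.L2Operator

namespace Summit.QuantumFields.BalabanUV.Beta.GAN24.DerivativeRateTransferGamma

open Literature.MathematicalPhysics.QuantumFieldTheory.Balaban1983to89.Beta.Composition (blockProp)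
open Literature.MathematicalPhysics.QuantumFieldTheory.Balaban1983to89.Beta.Envelope
  (minMap minMapL constrProp mul_constrProp constrProp_mul_transpose constraint_mul_constrProp)
open Summit.QuantumFields.BalabanUV.Beta.GAN24.DerivativeRateTransferEnvelope
  (norm_mul₃_le_of abs_re_entry_le_norm re_entry_sub_add_smul)
open Summit.QuantumFields.BalabanUV.Beta.GAN24.DerivativeRateTransfer (TransferInput₁)

/-! ## §1 The constrained resolvent identity -/

section Algebra

variable {𝕜 : Type*} [Field 𝕜]
variable {ν μ : Type*} [Fintype ν] [Fintype μ] [DecidableEq ν] [DecidableEq μ]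

/-- `G K = 1 − H Q` (right-multiplication companion of `Beta.Envelope.mul_constrProp`). [folklore] -/
theorem constrProp_mul_self (K : Matrix ν ν 𝕜) (Q : Matrix μ ν 𝕜) (hK : IsUnit K.det) :
    constrProp K Q * K = 1 - minMap K Q * Q := by
  simp only [constrProp, Matrix.sub_mul, Matrix.mul_assoc, Matrix.nonsing_inv_mul _ hK, Matrix.mul_one]

/-- **CONSTRAINED RESOLVENT IDENTITY** (exact): for two invertible forms `K₀, K₁` with the same constraint map `Q` and invertible block
propagators, `G₁ − G₀ = −G₀ (K₁ − K₀) G₁`.  Proof: `G₀K₁G₁ = G₀(1 − QᵀH₁ᴸ) = G₀` and `G₀K₀G₁ = (1 − H₀Q)G₁ = G₁`. [folklore] -/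
theorem constrProp_sub_constrProp (K₀ K₁ : Matrix ν ν 𝕜) (Q : Matrix μ ν 𝕜) (hK₀ : IsUnit K₀.det) (hK₁ : IsUnit K₁.det)
    (hP₀ : IsUnit (blockProp K₀ Q).det) (hP₁ : IsUnit (blockProp K₁ Q).det) :
    constrProp K₁ Q - constrProp K₀ Q = -(constrProp K₀ Q * (K₁ - K₀) * constrProp K₁ Q) := by
  have h1 : constrProp K₀ Q * K₁ * constrProp K₁ Q = constrProp K₀ Q := by
    rw [Matrix.mul_assoc, mul_constrProp K₁ Q hK₁, Matrix.mul_sub, Matrix.mul_one, ← Matrix.mul_assoc,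
      constrProp_mul_transpose K₀ Q hP₀, Matrix.zero_mul, sub_zero]
  have h2 : constrProp K₀ Q * K₀ * constrProp K₁ Q = constrProp K₁ Q := by
    rw [constrProp_mul_self K₀ Q hK₀, Matrix.sub_mul, Matrix.one_mul, Matrix.mul_assoc,
      constraint_mul_constrProp K₁ Q hP₁, Matrix.mul_zero, sub_zero]
  rw [Matrix.mul_sub, Matrix.sub_mul, h1, h2]
  abel

end Algebra

/-! ## §2 The fluctuation block along a background family -/

section Gamma

variable {ν μ : Type*} [Fintype ν] [Fintype μ] [DecidableEq ν] [DecidableEq μ]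
variable (K : ℝ → Matrix ν ν ℂ) (Q : Matrix μ ν ℂ) (K1 : Matrix ν ν ℂ)

/-- **Exact symmetric-difference identity for the fluctuation block**:
`G(h) − G(−h) + 2h·G₀K′G₀ = −G₀(K(h) − K(−h) − 2h·K′)G₀ + (G₀E₊(G₀E₊G₊) − G₀E₋(G₀E₋G₋))`, `E_± = K(±h) − K(0)`. -/
theorem constrProp_sym_diff_eq (h : ℝ) (hK0 : IsUnit (K 0).det) (hKp : IsUnit (K h).det) (hKm : IsUnit (K (-h)).det)
    (hP0 : IsUnit (blockProp (K 0) Q).det) (hPp : IsUnit (blockProp (K h) Q).det) (hPm : IsUnit (blockProp (K (-h)) Q).det) :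
    (constrProp (K h) Q - constrProp (K (-h)) Q) + ((2 * h : ℂ)) • (constrProp (K 0) Q * K1 * constrProp (K 0) Q)
      = -(constrProp (K 0) Q * ((K h - K (-h)) - ((2 * h : ℂ)) • K1) * constrProp (K 0) Q)
        + (constrProp (K 0) Q * (K h - K 0) * (constrProp (K 0) Q * (K h - K 0) * constrProp (K h) Q)
          - constrProp (K 0) Q * (K (-h) - K 0) * (constrProp (K 0) Q * (K (-h) - K 0) * constrProp (K (-h)) Q)) := by
  have gp := constrProp_sub_constrProp (K 0) (K h) Q hK0 hKp hP0 hPp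
  have gm := constrProp_sub_constrProp (K 0) (K (-h)) Q hK0 hKm hP0 hPm
  have ip : constrProp (K 0) Q * (K h - K 0) * constrProp (K h) Q = -(constrProp (K h) Q - constrProp (K 0) Q) := by
    rw [gp, neg_neg]
  have im : constrProp (K 0) Q * (K (-h) - K 0) * constrProp (K (-h)) Q = -(constrProp (K (-h)) Q - constrProp (K 0) Q) := by
    rw [gm, neg_neg]
  rw [ip, im]
  conv_lhs =>
    rw [show constrProp (K h) Q - constrProp (K (-h)) Q
        = (constrProp (K h) Q - constrProp (K 0) Q) - (constrProp (K (-h)) Q - constrProp (K 0) Q) from by abel, gp, gm]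
  simp only [Matrix.mul_sub, Matrix.sub_mul, Matrix.mul_smul, Matrix.smul_mul, Matrix.mul_neg, Matrix.mul_assoc]
  abel

variable {K Q K1}

/-- **S3, FIRST ORDER, FOR THE FLUCTUATION BLOCK** — from uniform bounds along the family: `‖G(s)‖ ≤ B_G` on `|s| ≤ γ`, `‖K(s) − K(0)‖ ≤ L_K|s|`,
`‖K(h) − K(−h) − 2h·K′‖ ≤ M_K h²` give `‖G(h) − G(−h) + 2h·G₀K′G₀‖ ≤ B_G²(M_K + 2B_G L_K²)·h²` (`0 < h ≤ γ`); insertion `∂_sG(0) = −G₀K′G₀`. -/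
theorem constrProp_taylor_form {γ BG LK MK : ℝ}
    (hKu : ∀ s : ℝ, |s| ≤ γ → IsUnit (K s).det) (hPu : ∀ s : ℝ, |s| ≤ γ → IsUnit (blockProp (K s) Q).det)
    (hG : ∀ s : ℝ, |s| ≤ γ → ‖constrProp (K s) Q‖ ≤ BG) (hLip : ∀ s : ℝ, |s| ≤ γ → ‖K s - K 0‖ ≤ LK * |s|)
    (hTay : ∀ h : ℝ, 0 < h → h ≤ γ → ‖(K h - K (-h)) - ((2 * h : ℂ)) • K1‖ ≤ MK * h ^ 2)
    (hLK : 0 ≤ LK) {h : ℝ} (hh : 0 < h) (hhγ : h ≤ γ) :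
    ‖(constrProp (K h) Q - constrProp (K (-h)) Q) + ((2 * h : ℂ)) • (constrProp (K 0) Q * K1 * constrProp (K 0) Q)‖
      ≤ BG ^ 2 * (MK + 2 * BG * LK ^ 2) * h ^ 2 := by
  have hγ : 0 ≤ γ := hh.le.trans hhγ
  have h0 : |(0:ℝ)| ≤ γ := by rwa [abs_zero]
  have hp : |h| ≤ γ := by rwa [abs_of_pos hh]
  have hm : |(-h)| ≤ γ := by rwa [abs_neg, abs_of_pos hh]
  rw [constrProp_sym_diff_eq K Q K1 h (hKu 0 h0) (hKu h hp) (hKu _ hm) (hPu 0 h0) (hPu h hp) (hPu _ hm)]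
  have hEp : ‖K h - K 0‖ ≤ LK * h := by simpa [abs_of_pos hh] using hLip h hp
  have hEm : ‖K (-h) - K 0‖ ≤ LK * h := by simpa [abs_neg, abs_of_pos hh] using hLip (-h) hm
  have hMK : 0 ≤ MK * h ^ 2 := (norm_nonneg _).trans (hTay h hh hhγ)
  have hLh : 0 ≤ LK * h := by positivity
  have t1 : ‖constrProp (K 0) Q * ((K h - K (-h)) - ((2 * h : ℂ)) • K1) * constrProp (K 0) Q‖ ≤ BG * (MK * h ^ 2) * BG :=
    norm_mul₃_le_of (hG 0 h0) (hTay h hh hhγ) (hG 0 h0) hMK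
  have t2 : ‖constrProp (K 0) Q * (K h - K 0) * (constrProp (K 0) Q * (K h - K 0) * constrProp (K h) Q)‖
      ≤ BG * (LK * h) * (BG * (LK * h) * BG) :=
    norm_mul₃_le_of (hG 0 h0) hEp (norm_mul₃_le_of (hG 0 h0) hEp (hG h hp) hLh) hLh
  have t3 : ‖constrProp (K 0) Q * (K (-h) - K 0) * (constrProp (K 0) Q * (K (-h) - K 0) * constrProp (K (-h)) Q)‖
      ≤ BG * (LK * h) * (BG * (LK * h) * BG) :=
    norm_mul₃_le_of (hG 0 h0) hEm (norm_mul₃_le_of (hG 0 h0) hEm (hG (-h) hm) hLh) hLh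
  calc _ ≤ ‖-(constrProp (K 0) Q * ((K h - K (-h)) - ((2 * h : ℂ)) • K1) * constrProp (K 0) Q)‖
        + ‖constrProp (K 0) Q * (K h - K 0) * (constrProp (K 0) Q * (K h - K 0) * constrProp (K h) Q)
          - constrProp (K 0) Q * (K (-h) - K 0) * (constrProp (K 0) Q * (K (-h) - K 0) * constrProp (K (-h)) Q)‖ := norm_add_le _ _
    _ ≤ BG * (MK * h ^ 2) * BG + (BG * (LK * h) * (BG * (LK * h) * BG) + BG * (LK * h) * (BG * (LK * h) * BG)) := by
        rw [norm_neg]; exact add_le_add t1 ((norm_sub_le _ _).trans (add_le_add t2 t3))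
    _ = BG ^ 2 * (MK + 2 * BG * LK ^ 2) * h ^ 2 := by ring

/-! ## §3 Entries and the family junction -/

/-- **Fluctuation-block ENTRIES in PART 1's Taylor form**: `F(s) = Re G(s)_{yy′}`, `dF = −Re (G₀K′G₀)_{yy′}`:
`|dF·2h − (F(h) − F(−h))| ≤ B_G²(M_K + 2B_G L_K²)·h²`. -/
theorem constrProp_taylor_form_entry_re {γ BG LK MK : ℝ}
    (hKu : ∀ s : ℝ, |s| ≤ γ → IsUnit (K s).det) (hPu : ∀ s : ℝ, |s| ≤ γ → IsUnit (blockProp (K s) Q).det)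
    (hG : ∀ s : ℝ, |s| ≤ γ → ‖constrProp (K s) Q‖ ≤ BG) (hLip : ∀ s : ℝ, |s| ≤ γ → ‖K s - K 0‖ ≤ LK * |s|)
    (hTay : ∀ h : ℝ, 0 < h → h ≤ γ → ‖(K h - K (-h)) - ((2 * h : ℂ)) • K1‖ ≤ MK * h ^ 2)
    (hLK : 0 ≤ LK) {h : ℝ} (hh : 0 < h) (hhγ : h ≤ γ) (y y' : ν) :
    |(-((constrProp (K 0) Q * K1 * constrProp (K 0) Q) y y').re) * (2 * h)
        - (((constrProp (K h) Q) y y').re - ((constrProp (K (-h)) Q) y y').re)|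
      ≤ BG ^ 2 * (MK + 2 * BG * LK ^ 2) * h ^ 2 := by
  have hmat := constrProp_taylor_form (K1 := K1) hKu hPu hG hLip hTay hLK hh hhγ
  have he := re_entry_sub_add_smul (constrProp (K h) Q) (constrProp (K (-h)) Q) (constrProp (K 0) Q * K1 * constrProp (K 0) Q)
    (2 * h) y y'
  have hentry := abs_re_entry_le_norm
    (((constrProp (K h) Q - constrProp (K (-h)) Q) + ((2 * h : ℝ) : ℂ) • (constrProp (K 0) Q * K1 * constrProp (K 0) Q))) y y'
  rw [he] at hentry
  push_cast at hentry
  rw [abs_sub_comm]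
  calc |((constrProp (K h) Q) y y').re - ((constrProp (K (-h)) Q) y y').re
          - (-((constrProp (K 0) Q * K1 * constrProp (K 0) Q) y y').re) * (2 * h)|
      = |((constrProp (K h) Q) y y').re - ((constrProp (K (-h)) Q) y y').re
          + 2 * h * ((constrProp (K 0) Q * K1 * constrProp (K 0) Q) y y').re| := by ring_nf
    _ ≤ _ := hentry
    _ ≤ _ := hmat

end Gamma

section Family

variable {ν μ : Type*} [Fintype ν] [Fintype μ] [DecidableEq ν] [DecidableEq μ]

/-- **`TransferInput₁` FOR THE FLUCTUATION-BLOCK ENTRY FAMILY** (fixed finite index sets — MODEL statement): uniform-in-`k` bounds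
`‖G_k(s)‖ ≤ B_G` on `|s| ≤ γ`, `‖K_k(s) − K_k(0)‖ ≤ L_K|s|`, `‖K_k(h) − K_k(−h) − 2hK′_k‖ ≤ M_K h²`, and a value-level rate
`|Re G_{k+1}(s)_{yy′} − Re G_k(s)_{yy′}| ≤ Cθ^k` (S1) give PART 1's [shape] with Taylor constant `B_G²(M_K + 2B_G L_K²)` — hence, by
`deriv_step_supRate`, the T1-type insertion entries `−Re (G_k(0)K′_kG_k(0))_{yy′}` are geometrically Cauchy at ratio `√θ`. -/
theorem transferInput₁_constrProp {K : ℕ → ℝ → Matrix ν ν ℂ} {Q : Matrix μ ν ℂ} {K1 : ℕ → Matrix ν ν ℂ} {γ BG LK MK C θ : ℝ}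
    (hKu : ∀ k (s : ℝ), |s| ≤ γ → IsUnit (K k s).det) (hPu : ∀ k (s : ℝ), |s| ≤ γ → IsUnit (blockProp (K k s) Q).det)
    (hG : ∀ k (s : ℝ), |s| ≤ γ → ‖constrProp (K k s) Q‖ ≤ BG) (hLip : ∀ k (s : ℝ), |s| ≤ γ → ‖K k s - K k 0‖ ≤ LK * |s|)
    (hTay : ∀ k (h : ℝ), 0 < h → h ≤ γ → ‖(K k h - K k (-h)) - ((2 * h : ℂ)) • K1 k‖ ≤ MK * h ^ 2) (hLK : 0 ≤ LK)
    (hstep : ∀ k (y y' : ν) (s : ℝ), |s| ≤ γ →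
      |((constrProp (K (k + 1) s) Q) y y').re - ((constrProp (K k s) Q) y y').re| ≤ C * θ ^ k) :
    TransferInput₁ (fun k s (y y' : ν) => ((constrProp (K k s) Q) y y').re)
      (fun k (y y' : ν) => -((constrProp (K k 0) Q * K1 k * constrProp (K k 0) Q) y y').re) γ
      (BG ^ 2 * (MK + 2 * BG * LK ^ 2)) C θ where
  taylor k y y' _ hh hhγ := constrProp_taylor_form_entry_re (hKu k) (hPu k) (hG k) (hLip k) (hTay k) hLK hh hhγ y y'
  step := hstep

end Family

end Summit.QuantumFields.BalabanUV.Beta.GAN24.DerivativeRateTransferGamma
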